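import Summits.HubbardSuperconductivity.HubbardSuperconductivity.Theses.DeformationLadder
import Summits.HubbardSuperconductivity.HubbardSuperconductivity.Theorems.DeformationLadderLowEnergyRigiditySpinSqueeze

/-!
# `LowEnergyRigidity` (crux stmt-HubbardSuperconductivity-1892, route `DeformationLadder`), spin squeeze III:
# partially polarised states in the energy window kill the rigidity matrix

Third of three negative-side support files (line lead a1; hand-off (a) of crux-ideate r2 k6).
`LowEnergyRigidity` claims: `∃ U>0, δ∈(0,½), κ>0, a>0, L₀, ∀ even L ≥ L₀`, every unit vector `φ` of
`szSector N_L 0` (`N_L = 2⌊(1-δ)L²/2⌋`) with `Re⟨φ, H_L φ⟩ ≤ minEnergyOn H_L (szSector N_L 0) + κ`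
(`H_L = hubbardTorus 2 L 1 U`) has `a ≤ L⁻⁴ Re⟨φ, Δ_dᴴΔ_d φ⟩`. By the total-spin squeeze
(`re_expect_pairField_le_of_spinSq`, file II):

* `not_rigid_of_polarised_window_state` — a unit `κ`-window vector of the crux's sector that is a
  total-spin eigenvector with `S > N_L/2 - aL²/32` refutes the rigidity matrix `(U, δ, κ, a)` at that side
  (`aL⁴ ≤ Re⟨Δ_dᴴΔ_d⟩_φ ≤ 32L²(N_L/2 - S) < aL⁴`); the saturated case `S = N_L/2` is the disprover's
  `LowEnergyRigidity.Negative.lowEnergyRigidity_matrix_false_of_ferromagnet_in_window`.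
* `lowEnergyRigidity_false_at_of_frequently_polarised_in_window` — window states with spin deficit
  `N_L/2 - S = o(L²)` at infinitely many even sides exclude every witness at `(U, δ, κ)`.
* `lowEnergyRigidity_spin_ceiling` — the crux BY NAME implies, at its witness `(U, δ, κ, a, L₀)`, the spin
  ceiling `S ≤ N_L/2 - aL²/32` for every `κ`-window total-spin eigenvector at every even side `L ≥ L₀`:
  PARTIAL ferromagnetism (polarisation `> 1 - a/(16(1-δ))`, not only saturation) is excluded from the
  window — a necessary condition every proof of the crux must reproduce (automatic below the Hartree
  threshold, where near-saturation costs an extensive energy; the live hazard is the Nagaoka corner).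

This file does NOT prove or refute the crux. References: H. Tasaki, Prog. Theor. Phys. 99 (1998) 489,
p. 20, §3.2, §4.4 (finite-density Nagaoka ferromagnetism is open); E. H. Lieb, PRL 62 (1989) 1201. Folklore.
-/

set_option linter.dupNamespace false

noncomputable section

namespace Summit.HubbardSuperconductivity.HubbardSuperconductivity.Theorems.DeformationLadder

open Matrix Finset Literature.MathematicalPhysics.QuantumLattice Literature.Probability.LatticeModels
open scoped Matrix.Norms.L2Operator ComplexOrder

/-! ### Consequences for the rigidity matrix of the crux -/

section Crux

open Summit.HubbardSuperconductivity.HubbardSuperconductivity.Theses.DeformationLadder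

/-- **A partially polarised state inside the window kills the rigidity matrix at that side.** If a
unit vector `φ` of the crux's sector `(N_L, S^z = 0)`, `N_L = 2⌊(1-δ)L²/2⌋`, lies within `κ` of the
sector ground energy of `hubbardTorus 2 L 1 U` and is a total-spin eigenvector with
`S > N_L/2 - aL²/32`, then NOT every unit window state has `d`-wave LRO density `≥ a`: by the spin
squeeze `a L⁴ ≤ Re⟨Δ_dᴴΔ_d⟩_φ ≤ 32L²(N_L/2 - S) < aL⁴`. The saturated case `S = N_L/2` is the
disprover's `rigidAt_false_of_ferromagnet_in_window` / `FerromagnetExclusion`. Tasaki (1998) p. 20. [folklore] -/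
theorem not_rigid_of_polarised_window_state (L : ℕ) [NeZero L] {U δ κ a S : ℝ}
    (φ : Fock (Orb (FermionTorus 2 L)))
    (hφ : φ ∈ szSector (2 * ⌊(1 - δ) * (L : ℝ) ^ 2 / 2⌋₊) 0)
    (hφ1 : star φ ⬝ᵥ φ = 1)
    (hspin : spinSq *ᵥ φ = ((S * (S + 1) : ℝ) : ℂ) • φ) (hS : 0 ≤ S)
    (hpol : ((2 * ⌊(1 - δ) * (L : ℝ) ^ 2 / 2⌋₊ : ℕ) : ℝ) / 2 - a * (L : ℝ) ^ 2 / 32 < S)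
    (hwin : (star φ ⬝ᵥ Matrix.mulVec (hubbardTorus 2 L 1 U) φ).re ≤
      (hubbardTorus 2 L 1 U).minEnergyOn
        (szSector (2 * ⌊(1 - δ) * (L : ℝ) ^ 2 / 2⌋₊) 0) + κ) :
    ¬ (∀ ψ : Fock (Orb (FermionTorus 2 L)),
        ψ ∈ szSector (2 * ⌊(1 - δ) * (L : ℝ) ^ 2 / 2⌋₊) 0 →
        star ψ ⬝ᵥ ψ = 1 →
        (star ψ ⬝ᵥ Matrix.mulVec (hubbardTorus 2 L 1 U) ψ).re ≤
          (hubbardTorus 2 L 1 U).minEnergyOn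
            (szSector (2 * ⌊(1 - δ) * (L : ℝ) ^ 2 / 2⌋₊) 0) + κ →
        a ≤ (expect ((pairField dWaveFormFactor L)ᴴ * pairField dWaveFormFactor L) ψ).re /
          (L : ℝ) ^ 4) := by
  intro h
  have hLRO := h φ hφ hφ1 hwin
  have hsq := re_expect_pairField_le_of_spinSq L _ S hS φ hφ hspin
  rw [hφ1, Complex.one_re, mul_one] at hsq
  have hLpos : (0 : ℝ) < (L : ℝ) := by exact_mod_cast Nat.pos_of_ne_zero (NeZero.ne L)
  have hL4 : (0 : ℝ) < (L : ℝ) ^ 4 := by positivity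
  have hL2 : (0 : ℝ) < (L : ℝ) ^ 2 := by positivity
  rw [le_div_iff₀ hL4] at hLRO
  have hlt : 32 * (L : ℝ) ^ 2 * (((2 * ⌊(1 - δ) * (L : ℝ) ^ 2 / 2⌋₊ : ℕ) : ℝ) / 2 - S) <
      a * (L : ℝ) ^ 4 := by
    have h1 : (((2 * ⌊(1 - δ) * (L : ℝ) ^ 2 / 2⌋₊ : ℕ) : ℝ) / 2 - S) < a * (L : ℝ) ^ 2 / 32 := by
      linarith
    have h2 := mul_lt_mul_of_pos_left h1 (mul_pos (by norm_num : (0:ℝ) < 32) hL2)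
    calc 32 * (L : ℝ) ^ 2 * (((2 * ⌊(1 - δ) * (L : ℝ) ^ 2 / 2⌋₊ : ℕ) : ℝ) / 2 - S)
        < 32 * (L : ℝ) ^ 2 * (a * (L : ℝ) ^ 2 / 32) := h2
      _ = a * (L : ℝ) ^ 4 := by ring
  linarith

/-- **Polarised low-energy states with `o(L²)` spin deficit at infinitely many even sides exclude
every witness at `(U, δ, κ)`.** If for every `ε > 0` and every `L₀` there is an even side `L ≥ L₀`
carrying a unit vector of `szSector N_L 0` inside the `κ`-window of `hubbardTorus 2 L 1 U` which is a
total-spin eigenvector with `S > N_L/2 - εL²`, then no order `a > 0` and no `L₀` complete `(U, δ, κ)`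
to a witness of the `LowEnergyRigidity` matrix. Contrapositive (the prover's reading): a witness
`(U, δ, κ, a, L₀)` certifies that every `κ`-window state of total spin `S` at an even side `L ≥ L₀`
has `S ≤ N_L/2 - aL²/32` — PARTIAL ferromagnetism of polarisation `> 1 - a/(16(1-δ))` (not only the
saturated ferromagnet of `FerromagnetExclusion`) is excluded from the window. Tasaki, Prog. Theor.
Phys. 99 (1998) 489, §3.2, §4.4 (Nagaoka-type ferromagnetism at finite hole density is open). [folklore] -/
theorem lowEnergyRigidity_false_at_of_frequently_polarised_in_window {U δ κ : ℝ}
    (hpol : ∀ ε : ℝ, 0 < ε → ∀ L₀ : ℕ, ∃ L : ℕ, ∃ _ : NeZero L, L₀ ≤ L ∧ Even L ∧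
      ∃ φ : Fock (Orb (FermionTorus 2 L)),
        φ ∈ szSector (2 * ⌊(1 - δ) * (L : ℝ) ^ 2 / 2⌋₊) 0 ∧
        star φ ⬝ᵥ φ = 1 ∧
        (star φ ⬝ᵥ Matrix.mulVec (hubbardTorus 2 L 1 U) φ).re ≤
          (hubbardTorus 2 L 1 U).minEnergyOn
            (szSector (2 * ⌊(1 - δ) * (L : ℝ) ^ 2 / 2⌋₊) 0) + κ ∧
        ∃ S : ℝ, 0 ≤ S ∧ spinSq *ᵥ φ = ((S * (S + 1) : ℝ) : ℂ) • φ ∧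
          ((2 * ⌊(1 - δ) * (L : ℝ) ^ 2 / 2⌋₊ : ℕ) : ℝ) / 2 - ε * (L : ℝ) ^ 2 < S) :
    ¬ ∃ a : ℝ, 0 < a ∧ ∃ L₀ : ℕ, ∀ (L : ℕ) [NeZero L], L₀ ≤ L → Even L →
      ∀ φ : Fock (Orb (FermionTorus 2 L)),
        φ ∈ szSector (2 * ⌊(1 - δ) * (L : ℝ) ^ 2 / 2⌋₊) 0 → star φ ⬝ᵥ φ = 1 →
        (star φ ⬝ᵥ Matrix.mulVec (hubbardTorus 2 L 1 U) φ).re ≤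
          (hubbardTorus 2 L 1 U).minEnergyOn (szSector (2 * ⌊(1 - δ) * (L : ℝ) ^ 2 / 2⌋₊) 0) + κ →
        a ≤ (expect ((pairField dWaveFormFactor L)ᴴ * pairField dWaveFormFactor L) φ).re /
          (L : ℝ) ^ 4 := by
  rintro ⟨a, ha, L₀, h⟩
  obtain ⟨L, _, hL, hev, φ, hφ, hφ1, hwin, S, hS, hspin, hpolS⟩ := hpol (a / 32) (by positivity) L₀
  have hpol' : ((2 * ⌊(1 - δ) * (L : ℝ) ^ 2 / 2⌋₊ : ℕ) : ℝ) / 2 - a * (L : ℝ) ^ 2 / 32 < S := by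
    have : a / 32 * (L : ℝ) ^ 2 = a * (L : ℝ) ^ 2 / 32 := by ring
    rwa [this] at hpolS
  exact not_rigid_of_polarised_window_state L φ hφ hφ1 hspin hS hpol' hwin (h L hL hev)

/-- **What a witness of the crux certifies about spin** (`LowEnergyRigidity` BY NAME ⇒ a spin
ceiling in the window): any witness `(U, δ, κ, a, L₀)` forces every `κ`-window unit vector of
`szSector N_L 0` at an even side `L ≥ L₀` that is a total-spin eigenvector, `S² φ = S(S+1)φ`, `S ≥ 0`,
to have `S ≤ N_L/2 - aL²/32`: the low-energy sector states of a phase-rigid `d`-wave superconductor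
are far from ferromagnetic (polarisation `≤ 1 - a/(16(1-δ)) + O(L⁻²)`). This is a necessary
condition every proof of the crux must reproduce and every refutation may target (Nagaoka corner).
Tasaki, Prog. Theor. Phys. 99 (1998) 489, §4.4. [folklore] -/
theorem lowEnergyRigidity_spin_ceiling :
    LowEnergyRigidity → ∃ U : ℝ, 0 < U ∧ ∃ δ ∈ Set.Ioo (0:ℝ) (1 / 2), ∃ κ : ℝ, 0 < κ ∧ ∃ a : ℝ, 0 < a ∧ ∃ L₀ : ℕ,
      ∀ (L : ℕ) [NeZero L], L₀ ≤ L → Even L → ∀ φ : Fock (Orb (FermionTorus 2 L)),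
        φ ∈ szSector (2 * ⌊(1 - δ) * (L : ℝ) ^ 2 / 2⌋₊) 0 →
        star φ ⬝ᵥ φ = 1 →
        (star φ ⬝ᵥ Matrix.mulVec (hubbardTorus 2 L 1 U) φ).re ≤
          (hubbardTorus 2 L 1 U).minEnergyOn
            (szSector (2 * ⌊(1 - δ) * (L : ℝ) ^ 2 / 2⌋₊) 0) + κ →
        ∀ S : ℝ, 0 ≤ S → spinSq *ᵥ φ = ((S * (S + 1) : ℝ) : ℂ) • φ →
          S ≤ ((2 * ⌊(1 - δ) * (L : ℝ) ^ 2 / 2⌋₊ : ℕ) : ℝ) / 2 - a * (L : ℝ) ^ 2 / 32 := by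
  rintro ⟨U, hU, δ, hδ, κ, hκ, a, ha, L₀, hR⟩
  refine ⟨U, hU, δ, hδ, κ, hκ, a, ha, L₀, fun L _ hL hev φ hφ hφ1 hwin S hS hspin => ?_⟩
  by_contra hlt
  exact not_rigid_of_polarised_window_state L φ hφ hφ1 hspin hS (not_le.1 hlt) hwin (hR L hL hev)

end Crux

end Summit.HubbardSuperconductivity.HubbardSuperconductivity.Theorems.DeformationLadder

end
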